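import Summits.ABC.ABC.Theorems.SomeWindowSaving.Negative.WindowFinite
import Summits.ABC.ABC.Theorems.SomeWindowSaving.Negative.FreyFamilyWindow
import Literature.NumberTheory.Sieve.SmoothNumbersLowerBoundLHalf

/-!
# No saving `δ < 1/3` in any window reaching below generalized-Szpiro ratio `4`

Negative-side theorem for the crux `TwistAmplification.SomeWindowSaving` (stmt-ABC-1976), a refuted
natural strengthening: `not_windowSaving_below_third :
¬ ∃ κ σ δ C, 0 < κ < 4 ∧ 12 < σ ∧ δ < 1/3 ∧ ∀ X ≥ 1, T⁺_[κ,σ](X) ≤ C X^δ`, from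
`T⁺_[κ,σ](X) ≥ #{primes in [p₀, (X/2¹³)^{1/3}]}` (Frey family) and Chebyshev's bound.  The crux's
own threshold `(σ−κ)/(2σ−6)` exceeds `4/9` on such windows, so the crux survives: this pins the
prover's room to `δ ∈ [1/3, (σ−κ)/(2σ−6))` whenever `κ < 4` (for `σ > 12`, as proved).  Chebyshev's
bound is reused from `Literature.NumberTheory.Sieve.div_four_mul_log_le_primeCounting`.
-/

noncomputable section

open UniqueFactorizationMonoid IsDedekindDomain Real WeierstrassCurve Rat.HeightOneSpectrum
open Literature.NumberTheory.EllipticCurves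

namespace Summit.ABC.ABC.Theorems.SomeWindowSaving.Negative

section Counting

/-- `freyFamily` is injective on `{p | 3 ∤ p}` (its `a₄ = −(3k² + k)` is strictly monotone in
`k = (4p² − 1)/3 ≥ 1`). -/
theorem injOn_freyFamily : Set.InjOn freyFamily {p : ℕ | ¬ 3 ∣ p} := by
  intro p hp q hq h
  have hp' : ¬ 3 ∣ p := hp
  have hq' : ¬ 3 ∣ q := hq
  have hp1 : 1 ≤ p := Nat.pos_of_ne_zero (by rintro rfl; exact hp' (dvd_zero 3))
  have hq1 : 1 ≤ q := Nat.pos_of_ne_zero (by rintro rfl; exact hq' (dvd_zero 3))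
  have hkp := one_le_kOf hp' hp1
  have hkq := one_le_kOf hq' hq1
  have ha : (freyFamily p).a₄ = (freyFamily q).a₄ := by rw [h]
  simp only [freyFamily] at ha
  have hk : kOf p = kOf q := by
    by_contra hne
    rcases lt_or_gt_of_ne hne with hlt | hlt <;> nlinarith
  have h3 := three_mul_kOf hp'
  have h3' := three_mul_kOf hq'
  have hsq : (p : ℤ) ^ 2 = (q : ℤ) ^ 2 := by rw [hk] at h3; linarith
  have : (p : ℤ) = q := (pow_left_inj₀ (by positivity) (by positivity) two_ne_zero).mp hsq
  exact_mod_cast this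

/-- **Counting.** For `0 < κ < 4 < 12 < σ`: every prime `p ∈ [p₀, Y]` contributes a distinct
element of the window slice at `X ≥ 2¹³ Y³`. -/
theorem card_primes_le_windowCount {κ σ : ℝ} (hκ0 : 0 < κ) (hκ : κ < 4) (hσ : 12 < σ) :
    ∃ p₀ : ℕ, 5 ≤ p₀ ∧ ∀ Y : ℕ, ∀ X : ℝ, (2 : ℝ) ^ 13 * (Y : ℝ) ^ 3 ≤ X →
      ((Finset.Icc p₀ Y).filter Nat.Prime).card ≤ windowCount κ σ X := by
  classical
  obtain ⟨p₀, h5, hmem⟩ := freyFamily_mem_windowSet hκ0 hκ hσ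
  refine ⟨p₀, h5, fun Y X hX ↦ ?_⟩
  set P := (Finset.Icc p₀ Y).filter Nat.Prime with hP
  have hinj : Set.InjOn freyFamily (P : Set ℕ) := by
    refine injOn_freyFamily.mono fun p hp ↦ ?_
    simp only [hP, Finset.coe_filter, Finset.mem_Icc, Set.mem_setOf_eq] at hp ⊢
    exact not_three_dvd_of_prime hp.2 (h5.trans hp.1.1)
  have hsub : ((P.image freyFamily : Finset (WeierstrassCurve ℤ)) : Set (WeierstrassCurve ℤ)) ⊆
      windowSet κ σ X := by
    intro W hW
    rw [Finset.coe_image] at hW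
    obtain ⟨p, hp, rfl⟩ := hW
    simp only [hP, Finset.coe_filter, Finset.mem_Icc, Set.mem_setOf_eq] at hp
    refine hmem p hp.2 hp.1.1 X (le_trans ?_ hX)
    have : (p : ℝ) ≤ Y := by exact_mod_cast hp.1.2
    gcongr
  calc P.card = (P.image freyFamily).card := (Finset.card_image_of_injOn hinj).symm
    _ = ((P.image freyFamily : Finset (WeierstrassCurve ℤ)) : Set (WeierstrassCurve ℤ)).ncard :=
        (Set.ncard_coe_finset _).symm
    _ ≤ windowCount κ σ X := Set.ncard_le_ncard hsub (windowSet_finite κ σ X)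

/-- `π(Y) ≤ #{primes in [p₀, Y]} + p₀`. -/
theorem primeCounting_le_card_add (p₀ Y : ℕ) :
    Nat.primeCounting Y ≤ ((Finset.Icc p₀ Y).filter Nat.Prime).card + p₀ := by
  rw [← Nat.primesLE_card_eq_primeCounting]
  have hsub : Nat.primesLE Y ⊆ (Finset.Icc p₀ Y).filter Nat.Prime ∪ Finset.range p₀ := by
    intro p hp
    rw [Nat.mem_primesLE] at hp
    by_cases h : p₀ ≤ p
    · exact Finset.mem_union_left _ (Finset.mem_filter.mpr ⟨Finset.mem_Icc.mpr ⟨h, hp.1⟩, hp.2⟩)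
    · exact Finset.mem_union_right _ (Finset.mem_range.mpr (by omega))
  calc (Nat.primesLE Y).card ≤ ((Finset.Icc p₀ Y).filter Nat.Prime ∪ Finset.range p₀).card :=
        Finset.card_le_card hsub
    _ ≤ ((Finset.Icc p₀ Y).filter Nat.Prime).card + (Finset.range p₀).card :=
        Finset.card_union_le _ _
    _ = _ := by rw [Finset.card_range]

/-- **Refuted strengthening (unconditional).**  No window reaching below generalized-Szpiro ratio
`4` (and up to ratio `> 12`) admits a saving `δ < 1/3`:
`¬ ∃ κ σ δ C, 0 < κ < 4, σ > 12, δ < 1/3, ∀ X ≥ 1, T⁺_[κ,σ](X) ≤ C X^δ`.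
The Frey curves of `1 + (4p² − 1) = 4p²` give `T⁺_[κ,σ](X) ≥ π((X/2¹³)^{1/3}) − O(1) ≫ X^{1/3}/log X`.
(For such windows the crux's threshold `(σ−κ)/(2σ−6)` exceeds `4/9 > 1/3`, so the crux itself
survives; this pins the prover's room to `δ ∈ [1/3, (σ−κ)/(2σ−6))` whenever `κ < 4`, for
`σ > 12` as proved.)  Chebyshev's bound is the tree's
`Literature.NumberTheory.Sieve.div_four_mul_log_le_primeCounting`. -/
theorem not_windowSaving_below_third :
    ¬ ∃ κ σ δ C : ℝ, 0 < κ ∧ κ < 4 ∧ 12 < σ ∧ δ < 1 / 3 ∧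
        ∀ X : ℝ, 1 ≤ X → (windowCount κ σ X : ℝ) ≤ C * X ^ δ := by
  rintro ⟨κ, σ, δ, C, hκ0, hκ, hσ, hδ, hcount⟩
  obtain ⟨p₀, -, hcard⟩ := card_primes_le_windowCount hκ0 hκ hσ
  set δ' : ℝ := max δ 0 with hδ'
  have hδ'0 : 0 ≤ δ' := le_max_right _ _
  have hδ'lt : δ' < 1 / 3 := max_lt hδ (by norm_num)
  set C' : ℝ := max C 0 * (2 : ℝ) ^ (13 * δ') with hC'
  have hC'0 : 0 ≤ C' := by positivity
  set r : ℝ := (1 - 3 * δ') / 2 with hr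
  have hr0 : 0 < r := by rw [hr]; linarith
  set c : ℝ := 1 / (8 * (C' + p₀ + 1)) with hc
  have hc0 : 0 < c := by positivity
  obtain ⟨Y₁, hY₁⟩ := Filter.eventually_atTop.mp ((isLittleO_log_rpow_atTop hr0).bound hc0)
  obtain ⟨Y, hY⟩ := exists_nat_ge (max Y₁ 4)
  have hYY₁ : Y₁ ≤ Y := (le_max_left _ _).trans hY
  have hY4 : (4 : ℝ) ≤ Y := (le_max_right _ _).trans hY
  have hY4' : 4 ≤ Y := by exact_mod_cast hY4
  have hY0 : (0 : ℝ) < Y := by linarith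
  have hY1 : (1 : ℝ) ≤ Y := by linarith
  set X : ℝ := (2 : ℝ) ^ 13 * (Y : ℝ) ^ 3 with hX
  have hX1 : 1 ≤ X := by
    rw [hX]
    have : (1 : ℝ) ≤ (Y : ℝ) ^ 3 := one_le_pow₀ hY1
    nlinarith
  -- (1) many primes ⇒ many curves
  have h1 : (Nat.primeCounting Y : ℝ) ≤ (windowCount κ σ X : ℝ) + p₀ := by
    have := (primeCounting_le_card_add p₀ Y).trans
      (Nat.add_le_add_right (hcard Y X le_rfl) p₀)
    exact_mod_cast this
  -- (2) the hypothesised saving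
  have h2 : (windowCount κ σ X : ℝ) ≤ C' * (Y : ℝ) ^ (3 * δ') := by
    have hXδ : X ^ δ ≤ X ^ δ' := Real.rpow_le_rpow_of_exponent_le hX1 (le_max_left _ _)
    have e : X ^ δ' = (2 : ℝ) ^ (13 * δ') * (Y : ℝ) ^ (3 * δ') := by
      rw [hX, Real.mul_rpow (by positivity) (by positivity)]
      congr 1
      · rw [show ((2 : ℝ) ^ 13 : ℝ) = (2 : ℝ) ^ (13 : ℝ) by norm_num, ← Real.rpow_mul (by norm_num)]
      · rw [show ((Y : ℝ) ^ 3 : ℝ) = (Y : ℝ) ^ (3 : ℝ) by norm_num, ← Real.rpow_mul hY0.le]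
    calc (windowCount κ σ X : ℝ) ≤ C * X ^ δ := hcount X hX1
      _ ≤ max C 0 * X ^ δ := by gcongr; exact le_max_left _ _
      _ ≤ max C 0 * X ^ δ' := mul_le_mul_of_nonneg_left hXδ (le_max_right _ _)
      _ = C' * (Y : ℝ) ^ (3 * δ') := by rw [e, hC']; ring
  -- (3) Chebyshev
  have h3 : (Y : ℝ) / (4 * Real.log Y) ≤ Nat.primeCounting Y :=
    Literature.NumberTheory.Sieve.div_four_mul_log_le_primeCounting hY4'
  -- (4) the analysis: C' Y^{3δ'} + p₀ < Y / (4 log Y)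
  have hlogpos : 0 < Real.log Y := Real.log_pos (by linarith)
  have hlogY : Real.log Y ≤ c * (Y : ℝ) ^ r := by
    have := hY₁ Y hYY₁
    rwa [Real.norm_of_nonneg hlogpos.le, Real.norm_of_nonneg (by positivity)] at this
  have h4 : C' * (Y : ℝ) ^ (3 * δ') + p₀ < (Y : ℝ) / (4 * Real.log Y) := by
    rw [lt_div_iff₀ (by positivity)]
    have hY3 : (1 : ℝ) ≤ (Y : ℝ) ^ (3 * δ') := Real.one_le_rpow hY1 (by positivity)
    have hexp : (Y : ℝ) ^ (3 * δ') * (Y : ℝ) ^ r ≤ Y := by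
      rw [← Real.rpow_add hY0]
      calc (Y : ℝ) ^ (3 * δ' + r) ≤ (Y : ℝ) ^ (1 : ℝ) :=
            Real.rpow_le_rpow_of_exponent_le hY1 (by rw [hr]; linarith)
        _ = Y := Real.rpow_one _
    have hcoef : 4 * c * (C' + p₀) < 1 := by
      rw [hc]
      have hpos : (0 : ℝ) < C' + p₀ + 1 := by positivity
      rw [show 4 * (1 / (8 * (C' + ↑p₀ + 1))) * (C' + ↑p₀) = (C' + p₀) / (2 * (C' + p₀ + 1)) by
        field_simp; ring]
      rw [div_lt_one (by positivity)]
      linarith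
    calc (C' * (Y : ℝ) ^ (3 * δ') + p₀) * (4 * Real.log Y)
        ≤ (C' * (Y : ℝ) ^ (3 * δ') + p₀ * (Y : ℝ) ^ (3 * δ')) * (4 * (c * (Y : ℝ) ^ r)) := by
          gcongr
          exact le_mul_of_one_le_right (by positivity) hY3
      _ = 4 * c * (C' + p₀) * ((Y : ℝ) ^ (3 * δ') * (Y : ℝ) ^ r) := by ring
      _ ≤ 4 * c * (C' + p₀) * Y := by gcongr
      _ < 1 * Y := by gcongr
      _ = Y := one_mul _
  linarith

end Counting

end Summit.ABC.ABC.Theorems.SomeWindowSaving.Negative
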